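import Mathlib
import HarnessLib
import Summits.Ventures.LatticeQCDFlow.Scaling.ImportanceWeights
import Summits.Ventures.LatticeQCDFlow.Exactness.FlowMCMC

/-!
# LatticeQCDFlow / Scaling — NO CEILING on the acceptance from the training loss alone: for every
# `D` and every `a < 1` there is a two-point target/model pair with `D(q‖p) ≥ D` and `acc ≥ a`

HONEST FRAMING: exact (Metropolis-corrected) sampling algorithms for lattice gauge theory;
figures of merit are autocorrelation/cost numbers at stated couplings and volumes; no
continuum-physics claim.

Venture `LatticeQCDFlow` (cell pub-lqcd), topic `Scaling`; FANOUT row 3 (`s0-u1-a`, S0-B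
implementation A, GEN-20).  NEW WORK of the cell (an explicit two-point witness); NO definition is
introduced; nothing is cited.  Row 3's floors bound the equilibrium acceptance of the exact flow
sampler FROM BELOW by the reverse training loss (`acc ≥ 1 − √(2D)`, `Scaling/AcceptancePinskerFloor`;
`acc ≥ ½e^{−2D}`, `Scaling/AcceptanceKLExponentialFloor` / `…FloorIntegral`) and
`Scaling/AcceptancePinskerFloor` listed "any CEILING on the acceptance from `D(q‖p)` alone" as NOT
CLAIMED.  This file shows no such ceiling exists: the reverse loss can be arbitrarily large while the
acceptance is arbitrarily close to `1` (a rare model state carrying an exponentially small target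
weight costs loss `≈ ε·M` but acceptance only `≈ 2ε`).

## Content (all `[ours]`), `X = Bool`, `accRate p q = Σ_x Σ_y min(p x q y, p y q x)`,
## `klFin a b = Σ a log(a/b)`

* `twoPoint_facts` — for `0 < ε ≤ ½`, `0 < δ < ε`: the laws `q = (1−ε, ε)`, `p = (1−δ, δ)` are
  positive and normalised, `accRate p q ≥ 1 − 2ε` and `klFin q p ≥ ε·log(ε/δ) + log(1 − ε)`;
* **`exists_klFin_ge_accRate_ge`** — for every real `D` and every `a < 1` there are positive
  normalised `p, q : Bool → ℝ` with `D ≤ klFin q p` and `a ≤ accRate p q`.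

Reading (value-free): the training loss floors the acceptance but cannot cap it; the large-volume
LAW `acc = erfc(√(D/2))` of row 3's GEN-20 files is a property of the factorised/diagonal regime,
not a general inequality.
NOT CLAIMED: anything about which regime a trained flow is in; nothing re-scored.
-/

namespace Summit.Ventures.LatticeQCDFlow.Theory2

open Finset Summit.Ventures.LatticeQCDFlow.Exactness

/-- The two-point witness: `q = (1−ε, ε)` (model), `p = (1−δ, δ)` (target), `0 < δ < ε ≤ ½`. [ours] -/
theorem twoPoint_facts {ε δ : ℝ} (hε0 : 0 < ε) (hε : ε ≤ 1 / 2) (hδ0 : 0 < δ) (hδε : δ < ε) :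
    let q : Bool → ℝ := fun b => if b then 1 - ε else ε
    let p : Bool → ℝ := fun b => if b then 1 - δ else δ
    (∀ b, 0 < p b) ∧ (∀ b, 0 < q b) ∧ (∑ b, p b = 1) ∧ (∑ b, q b = 1) ∧
      1 - 2 * ε ≤ accRate p q ∧ ε * Real.log (ε / δ) + Real.log (1 - ε) ≤ klFin q p := by
  intro q p
  have hδ1 : δ < 1 := by linarith
  have hε1 : ε < 1 := by linarith
  refine ⟨fun b => ?_, fun b => ?_, ?_, ?_, ?_, ?_⟩
  · cases b <;> simp [p] <;> linarith
  · cases b <;> simp [q] <;> linarith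
  · simp [p]
  · simp [q]
  · -- acceptance ≥ the diagonal terms `(1−δ)(1−ε) + δε ≥ 1 − ε − δ ≥ 1 − 2ε`
    simp only [accRate, Fintype.sum_bool, p, q, if_true, if_false, Bool.false_eq_true]
    have h1 : 0 ≤ min ((1 - δ) * ε) (δ * (1 - ε)) := le_min (by nlinarith) (by nlinarith)
    have h2 : 0 ≤ min (δ * (1 - ε)) ((1 - δ) * ε) := le_min (by nlinarith) (by nlinarith)
    rw [min_self, min_self]
    nlinarith
  · -- loss = (1−ε) log((1−ε)/(1−δ)) + ε log(ε/δ) ≥ log(1−ε) + ε log(ε/δ)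
    simp only [klFin, Fintype.sum_bool, p, q, if_true, if_false, Bool.false_eq_true]
    have hA : Real.log (1 - ε) ≤ (1 - ε) * Real.log ((1 - ε) / (1 - δ)) := by
      rw [Real.log_div (by linarith) (by linarith)]
      have hl1 : Real.log (1 - ε) ≤ 0 := Real.log_nonpos (by linarith) (by linarith)
      have hl2 : Real.log (1 - δ) ≤ 0 := Real.log_nonpos (by linarith) (by linarith)
      have hl3 : Real.log (1 - ε) ≤ Real.log (1 - δ) := Real.log_le_log (by linarith) (by linarith)
      nlinarith
    linarith

/-- **NO CEILING ON THE ACCEPTANCE FROM THE REVERSE LOSS**: for every real `D` and every `a < 1`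
there are positive normalised laws `p, q` on `Bool` with training loss `klFin q p ≥ D` and
equilibrium acceptance `accRate p q ≥ a`. [ours] -/
theorem exists_klFin_ge_accRate_ge (D a : ℝ) (ha : a < 1) :
    ∃ p q : Bool → ℝ, (∀ b, 0 < p b) ∧ (∀ b, 0 < q b) ∧ (∑ b, p b = 1) ∧ (∑ b, q b = 1) ∧
      D ≤ klFin q p ∧ a ≤ accRate p q := by
  -- `ε`: small enough for the acceptance; `δ = ε·e^{−M}` with `M` large enough for the loss
  set ε : ℝ := min (1 / 2) ((1 - a) / 2) with hε
  have hε0 : 0 < ε := by rw [hε]; exact lt_min (by norm_num) (by linarith)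
  have hε12 : ε ≤ 1 / 2 := min_le_left _ _
  have hεa : ε ≤ (1 - a) / 2 := min_le_right _ _
  -- choose `M ≥ 0` with `ε M + log(1 − ε) ≥ D`
  set M : ℝ := max 0 ((D - Real.log (1 - ε)) / ε) with hM
  have hM0 : 0 ≤ M := le_max_left _ _
  have hMD : D ≤ ε * M + Real.log (1 - ε) := by
    have : (D - Real.log (1 - ε)) / ε ≤ M := le_max_right _ _
    rw [div_le_iff₀ hε0] at this
    linarith
  set δ : ℝ := ε * Real.exp (-(M + 1)) with hδ
  have hδ0 : 0 < δ := mul_pos hε0 (Real.exp_pos _)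
  have hδε : δ < ε := by
    rw [hδ]
    have : Real.exp (-(M + 1)) < 1 := Real.exp_lt_one_iff.2 (by linarith)
    nlinarith
  obtain ⟨hp, hq, hp1, hq1, hacc, hkl⟩ := twoPoint_facts hε0 hε12 hδ0 hδε
  refine ⟨_, _, hp, hq, hp1, hq1, ?_, ?_⟩
  · -- `log(ε/δ) = M + 1`
    have hlog : Real.log (ε / δ) = M + 1 := by
      rw [hδ, show ε / (ε * Real.exp (-(M + 1))) = Real.exp (M + 1) by
        rw [Real.exp_neg]; field_simp, Real.log_exp]
    rw [hlog] at hkl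
    nlinarith
  · linarith

end Summit.Ventures.LatticeQCDFlow.Theory2
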